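import Summits.QuantumFields.YangMills.Theorems.AllWindowsColdBoxBoxHighWindowsSU22LineDefs

/-!
# TASK T-S5/U5.1 «smeared Faddeev–Popov identity» — the SHARED step (1) of the comparison stubs S5 (LINE-19 ⟨24004⟩/⟨24335⟩,
# `stub_landauSecondOrder`) and U5 (LINE-20 ⟨24336⟩, `stub_landauThirdOrder`): typed obligation Props, planner ym-idea-2 g17.

Both XL comparison stubs begin by trading the gauge-invariant box expectation for an expectation against a weight concentrated
near the Landau slice.  Instead of a δ-function gauge fixing (coarea on `SU(2)^{interior}`, not available), use the SMEARED identity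
('t Hooft averaging): for a gauge-invariant integrable `F`, a measurable bounded weight `h ≥ 0` and its orbit average
`N(U) = ∫ h(U^g) dg` over INTERIOR gauge transformations (product Haar), if `N > 0` then `∫ F · h / N dμ = ∫ F dμ` for the cold-wall box
state `μ = boxState ρ β H` — because `μ` is invariant under interior gauge transformations (T-S5.0 below: two tree lemmas,
`ymSpecification_map_gaugeTransformZd_holds` + `ymSpecification_congr_off`-type congruence, since an interior `g` fixes every link off
the box) and Fubini/Tonelli.  The Faddeev–Popov determinant then reappears ANALYTICALLY as the Laplace asymptotics of `N(U)` for a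
Gaussian-in-`d*A` weight `h` localised inside the Gribov ball where `stub_landauBallUniqueness` (✓p723285) makes the representative unique —
that is step (1b), not typed here.

T-S5.0 `BoxStateInteriorGaugeInvariant` (S): invariance of `boxState` under interior gauge transformations.
T-S5.1 `SmearedFPIdentity` (S–M): the averaging identity itself (measure theory only; no group-specific analysis).

HONEST LABEL: definitions/Props only; nothing is proved here; S5, U5, ⟨24004⟩ ⟨24335⟩ ⟨24336⟩ remain OPEN; U5's STAFFING stays gated by
critic prereg N2 (this shared step serves S5 now and is independent of N2); the Yang–Mills mass gap is NOT proved by this file.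
-/

set_option autoImplicit false

noncomputable section

open MeasureTheory Matrix
open Literature.MathematicalPhysics.QuantumFieldTheory
open Literature.MathematicalPhysics.QuantumLattice
open Summit.QuantumFields.YangMills.Theorems.WeakCouplingRates

namespace Summit.QuantumFields.YangMills.Theorems.AllWindowsColdBoxBoxHighLine

/-- Interior gauge transformations as functions on the finite set of interior sites. -/
abbrev InteriorGauge (H : ℕ) : Type := ↥(interiorSites H) → SU2

/-- Extension by the identity off the interior sites (so `IsInteriorGauge H (extendGauge H g)` holds by construction). -/
def extendGauge (H : ℕ) (g : InteriorGauge H) : Literature.Probability.LatticeModels.Site 4 → SU2 :=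
  fun x => if hx : x ∈ interiorSites H then g ⟨x, hx⟩ else 1

/-- Product Haar probability on the interior gauge transformations. -/
def interiorGaugeMeasure (H : ℕ) : Measure (InteriorGauge H) :=
  Measure.pi fun _ => haarProbability SU2

/-- Orbit average `N_h(U) = ∫ h(U^g) dg` of a weight over interior gauge transformations. -/
def orbitAverage (H : ℕ) (h : LGConfig 4 SU2 → ℝ) (U : LGConfig 4 SU2) : ℝ :=
  ∫ g, h (gaugeTransformZd (extendGauge H g) U) ∂(interiorGaugeMeasure H)

/-- **T-S5.0 (S).** The cold-wall box state is invariant under interior gauge transformations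
(from `ymSpecification_map_gaugeTransformZd_holds` and the fact that an interior `g` fixes the flat datum off the box). -/
def BoxStateInteriorGaugeInvariant : Prop :=
  ∀ (β : ℝ) (H : ℕ) (g : InteriorGauge H),
    (boxState (fundamentalRep (Fin 2)) β H).map (gaugeTransformZd (extendGauge H g)) =
      boxState (fundamentalRep (Fin 2)) β H

/-- **T-S5.1 (S–M) smeared Faddeev–Popov identity.**  For an interior-gauge-invariant integrable observable `F`, a measurable weight
`0 ≤ h ≤ M` with everywhere-positive orbit average, reweighting by `h / N_h` does not change the box expectation of `F`. -/
def SmearedFPIdentity : Prop :=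
  ∀ (β : ℝ) (H : ℕ) (F h : LGConfig 4 SU2 → ℝ),
    (∀ g : InteriorGauge H, ∀ U, F (gaugeTransformZd (extendGauge H g) U) = F U) →
    Integrable F (boxState (fundamentalRep (Fin 2)) β H) →
    Measurable h → (∀ U, 0 ≤ h U) → (∃ M : ℝ, ∀ U, h U ≤ M) →
    (∀ U, 0 < orbitAverage H h U) →
    ∫ U, F U * (h U / orbitAverage H h U) ∂(boxState (fundamentalRep (Fin 2)) β H) =
      ∫ U, F U ∂(boxState (fundamentalRep (Fin 2)) β H)

end Summit.QuantumFields.YangMills.Theorems.AllWindowsColdBoxBoxHighLine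

end
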